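import Summits.AnomalousDissipation.AnomalousDissipation.Theses.SteadyMirrorGate

/-!
# Glue of the SkeletonTubeCut split of `SteadyMirrorGate.NoMirrorDodgerTG` (stmt-AnomalousDissipation-33832)

Sorry-free proof of the GLUE item `SteadyMirrorGate.NoMirrorDodgerTGGlue` (stmt-AnomalousDissipation-27202):
`NoThinMirrorRootTG → NoFatMirrorRootTG → NoMirrorDodgerTG` — excluded middle on thinness at the skeleton (a K-symmetric
root of the Taylor–Green input is either thin or fat at the δ-tubes of the mirror-plane edge grid), plus the two kernel
necessities N ⇒ A and N ⇒ B (the cut is EXACT: N ⟺ A ∧ B).  Pure logic over the shared hypothesis block; no facts asserted.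
Source: decomp-ad cell, lens-6 g18 node «SkeletonTubeCut» (kernel `run/shared/lean/pub/decomp-ad/decomp-ad-lens-6/g18/SkeletonTubeCut.lean`,
theorems `noMirrorDodger_of` / `noDodger_iff_thin_and_fat`); landed by the cell's prover seat.  Nothing here proves the summit.
-/

set_option linter.dupNamespace false

namespace Summit.AnomalousDissipation.AnomalousDissipation.Theorems.SkeletonTubeCutGlue

open Summit.AnomalousDissipation.AnomalousDissipation.Theses
open Summit.AnomalousDissipation.AnomalousDissipation.Theses.SteadyMirrorGate

/-- A ∧ B ⇒ N: no thin mirror root and no fat mirror root ⇒ no mirror dodger (excluded middle on thinness). [folklore] -/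
theorem noMirrorDodgerTG_of_thin_fat (hA : NoThinMirrorRootTG) (hB : NoFatMirrorRootTG) : NoMirrorDodgerTG :=
  fun f hf v hV hK => Classical.byCases (hA f hf v hV hK) (hB f hf v hV hK)

/-- Kernel necessity N ⇒ A: `NoMirrorDodgerTG → NoThinMirrorRootTG`. [folklore] -/
theorem noThinMirrorRootTG_of_noMirrorDodgerTG (hN : NoMirrorDodgerTG) : NoThinMirrorRootTG :=
  fun f hf v hV hK _ => hN f hf v hV hK

/-- Kernel necessity N ⇒ B: `NoMirrorDodgerTG → NoFatMirrorRootTG`. [folklore] -/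
theorem noFatMirrorRootTG_of_noMirrorDodgerTG (hN : NoMirrorDodgerTG) : NoFatMirrorRootTG :=
  fun f hf v hV hK _ => hN f hf v hV hK

/-- EXACTNESS of the SkeletonTubeCut: `NoMirrorDodgerTG ↔ NoThinMirrorRootTG ∧ NoFatMirrorRootTG`. [folklore] -/
theorem noMirrorDodgerTG_iff_thin_and_fat : NoMirrorDodgerTG ↔ (NoThinMirrorRootTG ∧ NoFatMirrorRootTG) :=
  ⟨fun h => ⟨noThinMirrorRootTG_of_noMirrorDodgerTG h, noFatMirrorRootTG_of_noMirrorDodgerTG h⟩,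
   fun h => noMirrorDodgerTG_of_thin_fat h.1 h.2⟩

/-- GLUE item 27202 `NoMirrorDodgerTGGlue` by name (through the exactness of the cut). [folklore] -/
theorem noMirrorDodgerTGGlue_holds : NoMirrorDodgerTGGlue :=
  fun hA hB => noMirrorDodgerTG_iff_thin_and_fat.mpr ⟨hA, hB⟩

end Summit.AnomalousDissipation.AnomalousDissipation.Theorems.SkeletonTubeCutGlue
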